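import Summits.CriticalPhenomena.PercolationContinuityZ3.Theorems.PercNearOneGluingNoHeavyLowerTailForestRayleighSteps
import Summits.CriticalPhenomena.PercolationContinuityZ3.Theorems.PercNearOneGluingNoHeavyLowerTailForestRayleighStepsTwo
import HarnessLib

/-!
# Weighted forest negative correlation on graphs of tree-width ≤ 2 — IV: series vertex avoiding `e, f`, one edge pinned and one free

Notation as in `…ForestRayleighTools`: `Z(D;K) = Σ_{G ⊆ D, ⟨G ∪ K⟩ acyclic} ∏_{g∈G} w g` and the
Rayleigh inequality `(R)(D;K;e,f) : Z(D;K∪{e,f})·Z(D;K) ≤ Z(D;K∪{e})·Z(D;K∪{f})`.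

`lsm_series_pin_free`: the degree-two vertex `v` has the pinned edge `vu₁ ∈ K` and the free edge
`vu₂ ∈ D` (activity `w₂`), both different from `e, f`; chord `h = u₁u₂ ≠ f`. Eliminating `v`
turns the instance into `D₀ ∪ h` with the chord FREE of activity `w₂` (or `w h + w₂` if `h` was
already free), so `(R)(D;K;e,f)` follows from `(R)` for that re-weighted instance, and — when
`h ∈ K₀` or `h = e` — from `(R)(D₀;K₀;e,f)`. Graph-language form of Semple–Welsh, *Negative
correlation in graphs and matroids*, CPC 17 (2008), Prop. 3.7 (series extension).
Theorems only; no definitions, no `sorry`.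
-/

open Finset SimpleGraph
open scoped Classical

namespace Summit.CriticalPhenomena.PercolationContinuityZ3.Theorems.ForestRayleigh

variable {V : Type*} [Fintype V] [DecidableEq V]

omit [Fintype V] [DecidableEq V] in
/-- Real-algebra step: regrouping `(A + sB) + tB = A + (s+t)B` in a product inequality.
[elementary] -/
theorem real_regroup_le {A₁ B₁ A₂ B₂ A₃ B₃ A₄ B₄ s t : ℝ}
    (h : (A₁ + (s + t) * B₁) * (A₂ + (s + t) * B₂) ≤ (A₃ + (s + t) * B₃) * (A₄ + (s + t) * B₄)) :
    ((A₁ + s * B₁) + t * B₁) * ((A₂ + s * B₂) + t * B₂) ≤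
      ((A₃ + s * B₃) + t * B₃) * ((A₄ + s * B₄) + t * B₄) := by
  have e : ∀ A B : ℝ, (A + s * B) + t * B = A + (s + t) * B := fun A B => by ring
  simp only [e]; exact h

/-- **Series vertex with one edge pinned and one free.** `K = K₀ ∪ vu₁`, `D = D₀ ∪ vu₂`, `v` meets
no other edge of the instance, `h = u₁u₂ ≠ f`: `(R)(D;K;e,f)` follows from `(R)` for `D₀ ∪ h`
with `h` re-weighted to `c` (all `c ≥ 0`; used with `c = w(vu₂)` resp. `w h + w(vu₂)`), and from
`(R)(D₀;K₀;e,f)` when `h ∈ K₀` or `h = e`. [S–W Prop. 3.7, series case] -/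
theorem lsm_series_pin_free (w : Sym2 V → ℝ) (hw : ∀ x, 0 ≤ w x) (D₀ K₀ : Finset (Sym2 V))
    (e f : Sym2 V) {v u₁ u₂ : V}
    (hDK : ∀ x ∈ D₀ ∪ insert e (insert f (insert s(v, u₂) (insert s(v, u₁) K₀))), ¬x.IsDiag)
    (hv : ∀ x ∈ D₀ ∪ insert e (insert f K₀), v ∉ x) (hu : u₁ ≠ u₂) (hhf : s(u₁, u₂) ≠ f)
    (heD : e ∉ D₀) (heK : e ∉ K₀)
    (hred₁ : ∀ c : ℝ, 0 ≤ c → s(u₁, u₂) ∉ K₀ → s(u₁, u₂) ≠ e →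
      (∑ G ∈ (insert s(u₁, u₂) (D₀.erase s(u₁, u₂))).powerset.filter (fun G =>
        (fromEdgeSet ((G ∪ (insert e (insert f K₀)) : Finset (Sym2 V)) : Set (Sym2 V))).IsAcyclic), ∏ x ∈ G, Function.update w s(u₁, u₂) c x) *
      (∑ G ∈ (insert s(u₁, u₂) (D₀.erase s(u₁, u₂))).powerset.filter (fun G =>
        (fromEdgeSet ((G ∪ K₀ : Finset (Sym2 V)) : Set (Sym2 V))).IsAcyclic), ∏ x ∈ G, Function.update w s(u₁, u₂) c x) ≤
    (∑ G ∈ (insert s(u₁, u₂) (D₀.erase s(u₁, u₂))).powerset.filter (fun G =>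
        (fromEdgeSet ((G ∪ (insert e K₀) : Finset (Sym2 V)) : Set (Sym2 V))).IsAcyclic), ∏ x ∈ G, Function.update w s(u₁, u₂) c x) *
      (∑ G ∈ (insert s(u₁, u₂) (D₀.erase s(u₁, u₂))).powerset.filter (fun G =>
        (fromEdgeSet ((G ∪ (insert f K₀) : Finset (Sym2 V)) : Set (Sym2 V))).IsAcyclic), ∏ x ∈ G, Function.update w s(u₁, u₂) c x))
    (hred₂ : s(u₁, u₂) ∈ K₀ ∨ s(u₁, u₂) = e →
      (∑ G ∈ D₀.powerset.filter (fun G =>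
        (fromEdgeSet ((G ∪ (insert e (insert f K₀)) : Finset (Sym2 V)) : Set (Sym2 V))).IsAcyclic), ∏ x ∈ G, w x) *
      (∑ G ∈ D₀.powerset.filter (fun G =>
        (fromEdgeSet ((G ∪ K₀ : Finset (Sym2 V)) : Set (Sym2 V))).IsAcyclic), ∏ x ∈ G, w x) ≤
    (∑ G ∈ D₀.powerset.filter (fun G =>
        (fromEdgeSet ((G ∪ (insert e K₀) : Finset (Sym2 V)) : Set (Sym2 V))).IsAcyclic), ∏ x ∈ G, w x) *
      (∑ G ∈ D₀.powerset.filter (fun G =>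
        (fromEdgeSet ((G ∪ (insert f K₀) : Finset (Sym2 V)) : Set (Sym2 V))).IsAcyclic), ∏ x ∈ G, w x)) :
    (∑ G ∈ (insert s(v, u₂) D₀).powerset.filter (fun G =>
        (fromEdgeSet ((G ∪ (insert e (insert f (insert s(v, u₁) K₀))) : Finset (Sym2 V)) : Set (Sym2 V))).IsAcyclic), ∏ x ∈ G, w x) *
      (∑ G ∈ (insert s(v, u₂) D₀).powerset.filter (fun G =>
        (fromEdgeSet ((G ∪ (insert s(v, u₁) K₀) : Finset (Sym2 V)) : Set (Sym2 V))).IsAcyclic), ∏ x ∈ G, w x) ≤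
    (∑ G ∈ (insert s(v, u₂) D₀).powerset.filter (fun G =>
        (fromEdgeSet ((G ∪ (insert e (insert s(v, u₁) K₀)) : Finset (Sym2 V)) : Set (Sym2 V))).IsAcyclic), ∏ x ∈ G, w x) *
      (∑ G ∈ (insert s(v, u₂) D₀).powerset.filter (fun G =>
        (fromEdgeSet ((G ∪ (insert f (insert s(v, u₁) K₀)) : Finset (Sym2 V)) : Set (Sym2 V))).IsAcyclic), ∏ x ∈ G, w x) := by
  have hvu₁ : v ≠ u₁ := fun hh => hDK s(v, u₁) (by simp) (Sym2.mk_isDiag_iff.2 hh)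
  have hvu₂ : v ≠ u₂ := fun hh => hDK s(v, u₂) (by simp) (Sym2.mk_isDiag_iff.2 hh)
  have hve : v ∉ e := hv e (by simp)
  have hvf : v ∉ f := hv f (by simp)
  have hg₂D : s(v, u₂) ∉ D₀ := fun hh => hv _ (Finset.mem_union_left _ hh) (Sym2.mem_mk_left _ _)
  have hnd : ¬(s(u₁, u₂) : Sym2 V).IsDiag := fun hh => hu (Sym2.mk_isDiag_iff.1 hh)
  have hef : s(u₁, u₂) = e → e ≠ f := fun hh => hh ▸ hhf
  -- pinned sets with `vu₁` outermost, and loop-freeness / `v`-freeness of the remainders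
  have cₑ : insert e (insert s(v, u₁) K₀) = insert s(v, u₁) (insert e K₀) := Finset.insert_comm _ _ _
  have c_f : insert f (insert s(v, u₁) K₀) = insert s(v, u₁) (insert f K₀) := Finset.insert_comm _ _ _
  have cₑf : insert e (insert f (insert s(v, u₁) K₀)) = insert s(v, u₁) (insert e (insert f K₀)) := by
    rw [Finset.insert_comm f s(v, u₁), Finset.insert_comm e s(v, u₁)]
  have ndX : ∀ D' X : Finset (Sym2 V), D' ⊆ D₀ → X ⊆ insert e (insert f K₀) →
      ∀ x ∈ D' ∪ X, ¬x.IsDiag := by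
    intro D' X hD' hX x hx
    apply hDK x
    rcases Finset.mem_union.1 hx with hx | hx
    · exact Finset.mem_union_left _ (hD' hx)
    · apply Finset.mem_union_right
      have hx' := hX hx
      simp only [Finset.mem_insert] at hx' ⊢
      rcases hx' with hx' | hx' | hx'
      · exact Or.inl hx'
      · exact Or.inr (Or.inl hx')
      · exact Or.inr (Or.inr (Or.inr (Or.inr hx')))
  have hvX : ∀ D' X : Finset (Sym2 V), D' ⊆ D₀ → X ⊆ insert e (insert f K₀) →
      ∀ x ∈ D' ∪ X, v ∉ x := fun D' X hD' hX x hx =>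
    hv x (Finset.union_subset_union hD' hX hx)
  have X₀ : K₀ ⊆ insert e (insert f K₀) := (Finset.subset_insert _ _).trans (Finset.subset_insert _ _)
  have Xₑ : insert e K₀ ⊆ insert e (insert f K₀) :=
    Finset.insert_subset_insert e (Finset.subset_insert _ _)
  have X_f : insert f K₀ ⊆ insert e (insert f K₀) := Finset.subset_insert _ _
  have X₂ : insert e (insert f K₀) ⊆ insert e (insert f K₀) := subset_rfl
  -- normalise, split off the free edge `vu₂`, drop the pinned pendant `vu₁` where `vu₂` is absent
  rw [cₑf, cₑ, c_f, forestsW_insert_split w D₀ _ hg₂D, forestsW_insert_split w D₀ _ hg₂D,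
    forestsW_insert_split w D₀ _ hg₂D, forestsW_insert_split w D₀ _ hg₂D,
    forestsW_pin_pendant w D₀ _ (ndX _ _ subset_rfl X₂) (hvX _ _ subset_rfl X₂) hvu₁.symm,
    forestsW_pin_pendant w D₀ _ (ndX _ _ subset_rfl X₀) (hvX _ _ subset_rfl X₀) hvu₁.symm,
    forestsW_pin_pendant w D₀ _ (ndX _ _ subset_rfl Xₑ) (hvX _ _ subset_rfl Xₑ) hvu₁.symm,
    forestsW_pin_pendant w D₀ _ (ndX _ _ subset_rfl X_f) (hvX _ _ subset_rfl X_f) hvu₁.symm]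
  -- the pinned triangle, for pinned sets containing `vu₁, vu₂` and `h`
  have tri : ∀ D' X : Finset (Sym2 V), D' ⊆ D₀ → (∀ x ∈ X, ¬x.IsDiag) → s(v, u₁) ∈ X → s(v, u₂) ∈ X →
      s(u₁, u₂) ∈ X → (∑ G ∈ D'.powerset.filter (fun G =>
        (fromEdgeSet ((G ∪ X : Finset (Sym2 V)) : Set (Sym2 V))).IsAcyclic), ∏ x ∈ G, w x) = 0 :=
    fun D' X _ hX h₁ h₂ hh => forestsW_pin_series_triangle w D' X hX hu hvu₁ hvu₂ h₁ h₂ hh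
  have ndT : ∀ X : Finset (Sym2 V), X ⊆ insert e (insert f K₀) →
      ∀ x ∈ insert s(v, u₂) (insert s(v, u₁) X), ¬x.IsDiag := by
    intro X hX x hx
    rcases Finset.mem_insert.1 hx with rfl | hx
    · exact fun hh => hvu₂ (Sym2.mk_isDiag_iff.1 hh)
    rcases Finset.mem_insert.1 hx with rfl | hx
    · exact fun hh => hvu₁ (Sym2.mk_isDiag_iff.1 hh)
    · exact ndX D₀ X subset_rfl hX x (Finset.mem_union_right _ hx)
  by_cases hK : s(u₁, u₂) ∈ K₀
  · have spec := hred₂ (Or.inl hK)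
    rw [tri D₀ _ subset_rfl (ndT _ X₂) (by simp) (by simp) (by simp [hK]),
      tri D₀ _ subset_rfl (ndT _ X₀) (by simp) (by simp) (by simp [hK]),
      tri D₀ _ subset_rfl (ndT _ Xₑ) (by simp) (by simp) (by simp [hK]),
      tri D₀ _ subset_rfl (ndT _ X_f) (by simp) (by simp) (by simp [hK])]
    simp only [mul_zero, add_zero]
    exact spec
  by_cases he : s(u₁, u₂) = e
  · have spec := hred₂ (Or.inr he)
    have hh₀ : s(u₁, u₂) ∉ D₀ ∪ K₀ := by
      rw [he, Finset.mem_union, not_or]; exact ⟨heD, heK⟩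
    have hh_f : s(u₁, u₂) ∉ D₀ ∪ insert f K₀ := by
      rw [he, Finset.mem_union, Finset.mem_insert, not_or, not_or]; exact ⟨heD, hef he, heK⟩
    rw [tri D₀ _ subset_rfl (ndT _ X₂) (by simp) (by simp) (by rw [he]; simp),
      tri D₀ _ subset_rfl (ndT _ Xₑ) (by simp) (by simp) (by rw [he]; simp),
      forestsW_pin_series w D₀ K₀ (ndX _ _ subset_rfl X₀) (hvX _ _ subset_rfl X₀) hu hvu₁ hvu₂ hh₀,
      forestsW_pin_series w D₀ (insert f K₀) (ndX _ _ subset_rfl X_f) (hvX _ _ subset_rfl X_f) hu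
        hvu₁ hvu₂ hh_f, he]
    simp only [mul_zero, add_zero]
    exact real_absorb spec
  by_cases hD : s(u₁, u₂) ∈ D₀
  · -- `h ∈ D₀`: split off `h` too; its activity merges with `w(vu₂)`
    have hD' : D₀ = insert s(u₁, u₂) (D₀.erase s(u₁, u₂)) := (Finset.insert_erase hD).symm
    have hh₁ : s(u₁, u₂) ∉ D₀.erase s(u₁, u₂) := Finset.notMem_erase _ _
    have sub₁ : D₀.erase s(u₁, u₂) ⊆ D₀ := Finset.erase_subset _ _
    have spec := hred₁ (w s(u₁, u₂) + w s(v, u₂)) (add_nonneg (hw _) (hw _)) hK he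
    rw [forestsW_insert_split _ _ _ hh₁, forestsW_insert_split _ _ _ hh₁,
      forestsW_insert_split _ _ _ hh₁, forestsW_insert_split _ _ _ hh₁,
      forestsW_update w _ _ _ _ hh₁, forestsW_update w _ _ _ _ hh₁, forestsW_update w _ _ _ _ hh₁,
      forestsW_update w _ _ _ _ hh₁, forestsW_update w _ _ _ _ hh₁, forestsW_update w _ _ _ _ hh₁,
      forestsW_update w _ _ _ _ hh₁, forestsW_update w _ _ _ _ hh₁, Function.update_self] at spec
    have hhX : ∀ X : Finset (Sym2 V), X ⊆ insert e (insert f K₀) → s(u₁, u₂) ∉ D₀.erase s(u₁, u₂) ∪ X := by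
      intro X hX hx
      rcases Finset.mem_union.1 hx with hx | hx
      · exact hh₁ hx
      · have hx' := hX hx
        simp only [Finset.mem_insert] at hx'
        rcases hx' with hx' | hx' | hx'
        · exact he hx'
        · exact hhf hx'
        · exact hK hx'
    have ndT' : ∀ X : Finset (Sym2 V), X ⊆ insert e (insert f K₀) →
        ∀ x ∈ insert s(u₁, u₂) (insert s(v, u₂) (insert s(v, u₁) X)), ¬x.IsDiag := by
      intro X hX x hx
      rcases Finset.mem_insert.1 hx with rfl | hx
      · exact hnd
      · exact ndT X hX x hx
    rw [hD', forestsW_insert_split w _ _ hh₁, forestsW_insert_split w _ _ hh₁,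
      forestsW_insert_split w _ _ hh₁, forestsW_insert_split w _ _ hh₁,
      forestsW_insert_split w _ _ hh₁, forestsW_insert_split w _ _ hh₁,
      forestsW_insert_split w _ _ hh₁, forestsW_insert_split w _ _ hh₁,
      tri _ _ sub₁ (ndT' _ X₂) (by simp) (by simp) (by simp),
      tri _ _ sub₁ (ndT' _ X₀) (by simp) (by simp) (by simp),
      tri _ _ sub₁ (ndT' _ Xₑ) (by simp) (by simp) (by simp),
      tri _ _ sub₁ (ndT' _ X_f) (by simp) (by simp) (by simp),
      forestsW_pin_series w _ _ (ndX _ _ sub₁ X₂) (hvX _ _ sub₁ X₂) hu hvu₁ hvu₂ (hhX _ X₂),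
      forestsW_pin_series w _ _ (ndX _ _ sub₁ X₀) (hvX _ _ sub₁ X₀) hu hvu₁ hvu₂ (hhX _ X₀),
      forestsW_pin_series w _ _ (ndX _ _ sub₁ Xₑ) (hvX _ _ sub₁ Xₑ) hu hvu₁ hvu₂ (hhX _ Xₑ),
      forestsW_pin_series w _ _ (ndX _ _ sub₁ X_f) (hvX _ _ sub₁ X_f) hu hvu₁ hvu₂ (hhX _ X_f)]
    simp only [mul_zero, add_zero]
    exact real_regroup_le spec
  · -- `h ∉ D₀`: the chord is new, with activity `w(vu₂)`
    have spec := hred₁ (w s(v, u₂)) (hw _) hK he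
    rw [Finset.erase_eq_of_notMem hD] at spec
    rw [forestsW_insert_split _ _ _ hD, forestsW_insert_split _ _ _ hD,
      forestsW_insert_split _ _ _ hD, forestsW_insert_split _ _ _ hD,
      forestsW_update w _ _ _ _ hD, forestsW_update w _ _ _ _ hD, forestsW_update w _ _ _ _ hD,
      forestsW_update w _ _ _ _ hD, forestsW_update w _ _ _ _ hD, forestsW_update w _ _ _ _ hD,
      forestsW_update w _ _ _ _ hD, forestsW_update w _ _ _ _ hD, Function.update_self] at spec
    have hhX : ∀ X : Finset (Sym2 V), X ⊆ insert e (insert f K₀) → s(u₁, u₂) ∉ D₀ ∪ X := by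
      intro X hX hx
      rcases Finset.mem_union.1 hx with hx | hx
      · exact hD hx
      · have hx' := hX hx
        simp only [Finset.mem_insert] at hx'
        rcases hx' with hx' | hx' | hx'
        · exact he hx'
        · exact hhf hx'
        · exact hK hx'
    rw [forestsW_pin_series w _ _ (ndX _ _ subset_rfl X₂) (hvX _ _ subset_rfl X₂) hu hvu₁ hvu₂
        (hhX _ X₂),
      forestsW_pin_series w _ _ (ndX _ _ subset_rfl X₀) (hvX _ _ subset_rfl X₀) hu hvu₁ hvu₂
        (hhX _ X₀),
      forestsW_pin_series w _ _ (ndX _ _ subset_rfl Xₑ) (hvX _ _ subset_rfl Xₑ) hu hvu₁ hvu₂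
        (hhX _ Xₑ),
      forestsW_pin_series w _ _ (ndX _ _ subset_rfl X_f) (hvX _ _ subset_rfl X_f) hu hvu₁ hvu₂
        (hhX _ X_f)]
    exact spec


end Summit.CriticalPhenomena.PercolationContinuityZ3.Theorems.ForestRayleigh
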